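import Summits.ValiantsHypothesis.ValiantsHypothesis.Theorems.BarrierLeverPartitionMinorsHitByVPHiddenStatesJoin

/-!
# Crux `PartitionMinorsHitByVP` (stmt-ValiantsHypothesis-19717), line `hidden-states`: stub 1 `stub_joinDoorWide`

Registered stub 1 (`Stmt.stub_joinDoorWide`) of the planner's skeleton
`Cruxes/PartitionMinorsHitByVP/Lines/hidden_states.lean` (valiant-natproofs-p1 g19, D-0145): THE WIDE JOIN DOOR — a join
of `m ≤ 2h` hidden cubes with `K ≤ h³` states each hits a layout inside `SmallCircuits ℂ (h+h) 8` as soon as both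
block-additive matrices are nonsingular (`h ≥ 3`). Proof = the landed explicit-size join door
`HiddenStates.partitionMinor_hit_of_hiddenJoin` (val-np-p3 g8, p558096) plus the size arithmetic
`(2h+2)²·(m(6h + K(6h+2) + K + 3) + m) + 2h + 1 ≤ 9h²·34h⁵ + 3h ≤ (2h)⁸` for `m ≤ 2h`, `K ≤ h³`, `h ≥ 3`.
Prover seat val-np-p3 g9 (lead of the line's constructions side). Definition-free; closes NO item (`--supports 19717`).

WHAT THIS IS NOT: not the conjecture node (`stub_universalJoinWide` / Q\*(h³) / Q_join(h²) stay open); nothing on crux 14610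
or VP ≠ VNP.
-/

set_option linter.dupNamespace false

namespace Summit.ValiantsHypothesis.ValiantsHypothesis.Theorems.BarrierLever.HiddenStatesLine

open Finset
open Literature.Barriers.ValiantsHypothesis (SmallCircuits)
open Summit.ValiantsHypothesis.ValiantsHypothesis.Theorems.BarrierLever.HiddenStates (partitionMinor_hit_of_hiddenJoin)

/-- THE WIDE JOIN DOOR (statement) — VERBATIM copy of `Stmt.stub_joinDoorWide` of the registered skeleton
`Cruxes/PartitionMinorsHitByVP/Lines/hidden_states.lean` (the Cruxes module is not an importable build target, so the
statement is restated here under the Theorems namespace; the registered stub signature is the name `Stmt.stub_joinDoorWide`):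
join witnesses with `m ≤ 2h` pieces of `K ≤ h³` hidden states each hit a layout inside `SmallCircuits ℂ (h+h) 8` as soon as
both block-additive matrices are nonsingular (`h ≥ 3`). -/
def Stmt.stub_joinDoorWide : Prop :=
  ∀ (h m K r : ℕ), 3 ≤ h → m ≤ h + h → K ≤ h * h * h →
    ∀ (u w : Fin r → Finset (Fin h)) (e : Fin r → Fin m × Finset (Fin K)), Function.Injective e →
      ∀ (W : Fin m → ℕ) (wt : Fin m → Fin K → ℕ),
        (∀ x : Fin m × Finset (Fin K), x ∉ Set.range e →
          ∀ i, W (e i).1 + ∑ k ∈ (e i).2, wt (e i).1 k < W x.1 + ∑ k ∈ x.2, wt x.1 k) →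
        ∀ (tx ty : Fin m → Option (Fin K) → Fin h → ℂ),
          (Matrix.of fun i k : Fin r =>
            ∏ a ∈ u i, (tx (e k).1 none a + ∑ q ∈ (e k).2, tx (e k).1 (some q) a)).det ≠ 0 →
          (Matrix.of fun j k : Fin r =>
            ∏ c ∈ w j, (ty (e k).1 none c + ∑ q ∈ (e k).2, ty (e k).1 (some q) c)).det ≠ 0 →
          ∃ f ∈ SmallCircuits ℂ (h + h) 8,
            (Matrix.of fun i j : Fin r => MvPolynomial.coeff
              (∑ a ∈ u i, Finsupp.single (Fin.castAdd h a) 1 +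
                ∑ c ∈ w j, Finsupp.single (Fin.natAdd h c) 1) f).det ≠ 0

/-- The size arithmetic of the wide join door: for `h ≥ 3`, `m ≤ 2h`, `K ≤ h³`,
`(2h+2)²·(m(3(2h) + K(3(2h)+2) + K + 1 + 2) + m) + (2h+1) ≤ (2h)⁸`. -/
theorem joinDoorWide_size (h m K : ℕ) (hh : 3 ≤ h) (hm : m ≤ h + h) (hK : K ≤ h * h * h) :
    (h + h + 2) ^ 2 * (m * (3 * (h + h) + (K * (3 * (h + h) + 2) + K) + 1 + 2) + m) + (h + h + 1) ≤
      (h + h) ^ 8 := by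
  -- abbreviate the powers of `h`
  obtain ⟨n, rfl⟩ : ∃ n, h = n + 3 := ⟨h - 3, by omega⟩
  set x := n + 3 with hx
  have x3 : 3 ≤ x := by omega
  have hp2 : x * x ≥ 3 * x := Nat.mul_le_mul_right x x3
  have hp3 : x * x * x ≥ 3 * (x * x) := by nlinarith
  have hp4 : x * x * x * x ≥ 3 * (x * x * x) := by nlinarith
  -- inner bracket
  have eK : K * (3 * (x + x) + 2) + K ≤ x * x * x * (3 * (x + x) + 2) + x * x * x := by gcongr
  have eIn : 3 * (x + x) + (K * (3 * (x + x) + 2) + K) + 1 + 2 ≤ 8 * (x * x * x * x) := by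
    have e1 : 3 * (x + x) + (x * x * x * (3 * (x + x) + 2) + x * x * x) + 1 + 2 =
        6 * (x * x * x * x) + 3 * (x * x * x) + 6 * x + 3 := by ring
    have e2 : 6 * x + 3 ≤ x * x * x := by nlinarith
    nlinarith
  have eM : m * (3 * (x + x) + (K * (3 * (x + x) + 2) + K) + 1 + 2) + m ≤ 17 * (x * x * x * x * x) := by
    calc m * (3 * (x + x) + (K * (3 * (x + x) + 2) + K) + 1 + 2) + m
        ≤ (x + x) * (8 * (x * x * x * x)) + (x + x) := by gcongr
      _ = 16 * (x * x * x * x * x) + 2 * x := by ring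
      _ ≤ 17 * (x * x * x * x * x) := by nlinarith
  have eSq : (x + x + 2) ^ 2 ≤ 9 * (x * x) := by
    have : x + x + 2 ≤ 3 * x := by omega
    calc (x + x + 2) ^ 2 ≤ (3 * x) ^ 2 := Nat.pow_le_pow_left this 2
      _ = 9 * (x * x) := by ring
  have eTail : x + x + 1 ≤ x * x * x * x * x * x * x := by nlinarith
  calc (x + x + 2) ^ 2 * (m * (3 * (x + x) + (K * (3 * (x + x) + 2) + K) + 1 + 2) + m) + (x + x + 1)
      ≤ 9 * (x * x) * (17 * (x * x * x * x * x)) + x * x * x * x * x * x * x := by gcongr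
    _ = 154 * (x * x * x * x * x * x * x) := by ring
    _ ≤ 256 * (x * x * x * x * x * x * x) * x := by nlinarith
    _ = (x + x) ^ 8 := by ring

/-- **Registered stub 1 of the line `hidden-states` = `Stmt.stub_joinDoorWide`: THE WIDE JOIN DOOR.** A join of `m ≤ 2h`
hidden cubes with `K ≤ h³` states each, whose two block-additive matrices on the layout `(u, w)` are nonsingular, yields
`f ∈ SmallCircuits ℂ (h+h) 8` with nonsingular layout determinant (`h ≥ 3`). -/
theorem stub_joinDoorWide : Stmt.stub_joinDoorWide := by
  intro h m K r hh hm hK u w e he W wt hthr tx ty hx hy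
  obtain ⟨f, hdeg, hsize, hf⟩ := partitionMinor_hit_of_hiddenJoin h m K r u w e he W wt hthr tx ty hx hy
  exact ⟨f, ⟨hdeg, hsize.trans (joinDoorWide_size h m K hh hm hK)⟩, hf⟩

end Summit.ValiantsHypothesis.ValiantsHypothesis.Theorems.BarrierLever.HiddenStatesLine
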